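import Literature.Analysis.FluidPDE.WholeSpaceIBP
import Literature.Analysis.FluidPDE.SolenoidalTruncation
import Literature.Analysis.FluidPDE.LerayProfileCalculus
import HarnessLib

/-!
# Strain doors — VIRIAL LIQUIDATION: a finite-energy divergence-free field with `div((u·∇)u) ≡ 0` vanishes

LEAD S-door engine plate (ns-s30-p1 g5), the analysis core of `StrainDoorsSegregationVacuity.lean` (exact vacuity of
door D11's segregation hypothesis, nsreg-p1 ROUND-48/49).  Pure calculus on `ℝ³`, no Navier–Stokes input:

* `fderiv_fderiv_virialTest_apply` — the Hessian of the virial test function `θ_R(x) = ½|x|²·χ_R(x)` (`χ_R` the tree's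
  `cutoff R`): `D²θ_R(x)(v,v) = χ_R(x)|v|² + 2⟪x,v⟫·Dχ_R(x)v + ½|x|²·D²χ_R(x)(v,v)`;
* `virialError_bound` — with the tree's `‖Dχ_R‖ ≤ C₁/R`, `‖D²χ_R‖ ≤ C₂/R²` (`exists_norm_fderiv_cutoff_le`,
  `exists_norm_fderiv_fderiv_cutoff_le`): the last two terms are `≤ (4C₁ + 2C₂)|v|²` and vanish for `|x| < R`
  (`fderiv_cutoff_eq_zero_inside`, `cutoff_derivs_eq_zero_outside`);
* `integral_hessian_apply_self_eq_zero` — THE TESTED VIRIAL IDENTITY: for `u ∈ C²` divergence free with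
  `div((u·∇)u) ≡ 0` and every `θ ∈ C²_c`, `∫ D²θ(u,u) = 0` (two integrations by parts: the tree's
  `integral_mul_divergence_add_eq_zero_left` and `integral_inner_convect_add_eq_zero`, `WholeSpaceIBP`);
* `eq_zero_of_divergence_convect_self_eq_zero` ★★ — VIRIAL LIQUIDATION: `u ∈ C²(ℝ³;ℝ³)`, `div u = 0`, `|u|² ∈ L¹`,
  `div((u·∇)u) ≡ 0` ⇒ `u ≡ 0` (`∫ χ_R|u|² = O(∫_{|x|≥R}|u|²) → 0` while `→ ∫|u|²`; dominated convergence along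
  `R = n + 1`).  This is the tensor virial theorem `∫ u_k u_l = ½∫ x_k x_l ∂_i∂_j(u_iu_j)` read at `∂_i∂_j(u_iu_j) = 0`;
  compare Chae's Liouville theorems for steady Euler flows via `∫(|u|² + 3p) = 0` and the tree's
  `ChaeWolf2016.radial_identity`.

HONEST FRAME: an analysis lemma serving a door-hypothesis analysis (helper lane of item 0056); no regularity statement;
item 0056 `NoTypeII` / 10661 / NS regularity are NOT proved.  `--supports stmt-NavierStokesRegularity-0056 --as helper`.
-/

noncomputable section

open MeasureTheory Set Function Filter InnerProductSpace Metric
open scoped RealInnerProductSpace ContDiff Topology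
open Literature.Analysis Literature.Analysis.FluidPDE

set_option linter.dupNamespace false

namespace Summit.NavierStokesRegularity.NavierStokesRegularity.Theorems.StrainDoors


/-- support: `x ↦ ½|x|²` has derivative `⟪x,·⟫`. -/
theorem hasFDerivAt_half_norm_sq (x : (EuclideanSpace ℝ (Fin 3))) :
    HasFDerivAt (fun y : (EuclideanSpace ℝ (Fin 3)) => ‖y‖ ^ 2 / 2) (innerSL ℝ x) x := by
  have h : HasFDerivAt (fun y : (EuclideanSpace ℝ (Fin 3)) => ‖y‖ ^ 2 * 2⁻¹) ((2⁻¹ : ℝ) • (2 : ℕ) • innerSL ℝ x) x :=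
    ((hasStrictFDerivAt_norm_sq x).hasFDerivAt).mul_const (2⁻¹ : ℝ)
  have hfun : (fun y : (EuclideanSpace ℝ (Fin 3)) => ‖y‖ ^ 2 / 2) = fun y => ‖y‖ ^ 2 * 2⁻¹ := by
    funext y; rw [div_eq_mul_inv]
  rw [hfun]
  refine h.congr_fderiv ?_
  ext v
  simp [two_nsmul]
  ring

/-- support: the virial test function `θ_R = ½|·|²·χ_R` is `C²`... indeed smooth. -/
theorem contDiff_virialTest (R : ℝ) {n : ℕ∞} : ContDiff ℝ n (fun x : (EuclideanSpace ℝ (Fin 3)) => ‖x‖ ^ 2 / 2 * cutoff R x) :=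
  ((contDiff_norm_sq ℝ).div_const 2).mul (contDiff_cutoff R)

/-- support: first derivative of `θ_R`. -/
theorem hasFDerivAt_virialTest (R : ℝ) (x : (EuclideanSpace ℝ (Fin 3))) :
    HasFDerivAt (fun y : (EuclideanSpace ℝ (Fin 3)) => ‖y‖ ^ 2 / 2 * cutoff R y)
      ((‖x‖ ^ 2 / 2) • fderiv ℝ (cutoff R) x + cutoff R x • innerSL ℝ x) x := by
  have hχ : HasFDerivAt (cutoff (E := EuclideanSpace ℝ (Fin 3)) R) (fderiv ℝ (cutoff R) x) x :=
    ((contDiff_cutoff (n := 1) R).differentiable (by simp) x).hasFDerivAt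
  have hs := hasFDerivAt_half_norm_sq x
  have h : HasFDerivAt (fun y : (EuclideanSpace ℝ (Fin 3)) => ‖y‖ ^ 2 / 2 * cutoff R y)
      ((‖x‖ ^ 2 / 2) • fderiv ℝ (cutoff R) x + cutoff R x • innerSL ℝ x) x := hs.mul hχ
  exact h

/-- support: the derivative of `θ_R` as a function. -/
theorem fderiv_virialTest (R : ℝ) :
    fderiv ℝ (fun y : (EuclideanSpace ℝ (Fin 3)) => ‖y‖ ^ 2 / 2 * cutoff R y) =
      fun x => (‖x‖ ^ 2 / 2) • fderiv ℝ (cutoff R) x + cutoff R x • innerSL ℝ x :=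
  funext fun x => (hasFDerivAt_virialTest R x).fderiv

/-- support: THE HESSIAN OF THE VIRIAL TEST FUNCTION:
`D²θ_R(x)(v,v) = χ_R(x)|v|² + 2⟪x,v⟫·Dχ_R(x)v + ½|x|²·D²χ_R(x)(v,v)`. -/
theorem fderiv_fderiv_virialTest_apply (R : ℝ) (x v : (EuclideanSpace ℝ (Fin 3))) :
    fderiv ℝ (fderiv ℝ (fun y : (EuclideanSpace ℝ (Fin 3)) => ‖y‖ ^ 2 / 2 * cutoff R y)) x v v =
      cutoff R x * ‖v‖ ^ 2 + 2 * ⟪x, v⟫ * fderiv ℝ (cutoff R) x v +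
        ‖x‖ ^ 2 / 2 * fderiv ℝ (fderiv ℝ (cutoff R)) x v v := by
  rw [fderiv_virialTest R]
  have hχ1 : HasFDerivAt (cutoff (E := EuclideanSpace ℝ (Fin 3)) R) (fderiv ℝ (cutoff R) x) x :=
    ((contDiff_cutoff (n := 1) R).differentiable (by simp) x).hasFDerivAt
  have hχ2 : HasFDerivAt (fderiv ℝ (cutoff (E := EuclideanSpace ℝ (Fin 3)) R)) (fderiv ℝ (fderiv ℝ (cutoff R)) x) x :=
    (((contDiff_cutoff (n := 2) R).fderiv_right (m := 1) (by norm_cast)).differentiable (by simp) x).hasFDerivAt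
  have hs := hasFDerivAt_half_norm_sq x
  have hL : HasFDerivAt (fun y : (EuclideanSpace ℝ (Fin 3)) => innerSL ℝ y)
      (innerSL ℝ : (EuclideanSpace ℝ (Fin 3)) →L[ℝ] (EuclideanSpace ℝ (Fin 3)) →L[ℝ] ℝ) x :=
    (innerSL ℝ : (EuclideanSpace ℝ (Fin 3)) →L[ℝ] (EuclideanSpace ℝ (Fin 3)) →L[ℝ] ℝ).hasFDerivAt
  have h1 := hs.smul hχ2
  have h2 := hχ1.smul hL
  have h : HasFDerivAt (fun y : (EuclideanSpace ℝ (Fin 3)) => (‖y‖ ^ 2 / 2) • fderiv ℝ (cutoff R) y + cutoff R y • innerSL ℝ y)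
      ((‖x‖ ^ 2 / 2) • fderiv ℝ (fderiv ℝ (cutoff R)) x + (innerSL ℝ x).smulRight (fderiv ℝ (cutoff R) x) +
        (cutoff R x • (innerSL ℝ : (EuclideanSpace ℝ (Fin 3)) →L[ℝ] (EuclideanSpace ℝ (Fin 3)) →L[ℝ] ℝ) +
          (fderiv ℝ (cutoff R) x).smulRight (innerSL ℝ x))) x :=
    h1.add h2
  rw [h.fderiv]
  have hv : (innerSL ℝ : (EuclideanSpace ℝ (Fin 3)) →L[ℝ] (EuclideanSpace ℝ (Fin 3)) →L[ℝ] ℝ) v v = ‖v‖ ^ 2 := by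
    rw [innerSL_apply_apply, real_inner_self_eq_norm_sq]
  simp [ContinuousLinearMap.smulRight_apply, hv]
  ring


/-- support: inside the ball `|x| < R` the cut-off is locally `1`, so `Dχ_R(x) = 0` and `D²χ_R(x) = 0`. -/
theorem fderiv_cutoff_eq_zero_inside {R : ℝ} (hR : 0 < R) {x : (EuclideanSpace ℝ (Fin 3))} (hx : ‖x‖ < R) :
    fderiv ℝ (cutoff R) x = 0 ∧ fderiv ℝ (fderiv ℝ (cutoff R)) x = 0 := by
  have hopen : IsOpen {y : (EuclideanSpace ℝ (Fin 3)) | ‖y‖ < R} := isOpen_lt continuous_norm continuous_const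
  have h1 : ∀ y : (EuclideanSpace ℝ (Fin 3)), ‖y‖ < R → fderiv ℝ (cutoff R) y = 0 := by
    intro y hy
    have hev : (cutoff (E := EuclideanSpace ℝ (Fin 3)) R) =ᶠ[𝓝 y] fun _ => (1 : ℝ) := by
      filter_upwards [hopen.mem_nhds hy] with z hz
      exact cutoff_eq_one hR (le_of_lt hz)
    rw [hev.fderiv_eq]; simp
  refine ⟨h1 x hx, ?_⟩
  have hev : fderiv ℝ (cutoff (E := EuclideanSpace ℝ (Fin 3)) R) =ᶠ[𝓝 x] fun _ => (0 : (EuclideanSpace ℝ (Fin 3)) →L[ℝ] ℝ) := by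
    filter_upwards [hopen.mem_nhds hx] with z hz
    exact h1 z hz
  rw [hev.fderiv_eq]; simp

/-- support: outside the ball `|x| > 2R` the cut-off is locally `0`, so `χ_R(x) = 0`, `Dχ_R(x) = 0`, `D²χ_R(x) = 0`. -/
theorem cutoff_derivs_eq_zero_outside {R : ℝ} (hR : 0 < R) {x : (EuclideanSpace ℝ (Fin 3))} (hx : 2 * R < ‖x‖) :
    cutoff R x = 0 ∧ fderiv ℝ (cutoff R) x = 0 ∧ fderiv ℝ (fderiv ℝ (cutoff R)) x = 0 := by
  have hopen : IsOpen {y : (EuclideanSpace ℝ (Fin 3)) | 2 * R < ‖y‖} := isOpen_lt continuous_const continuous_norm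
  have h1 : ∀ y : (EuclideanSpace ℝ (Fin 3)), 2 * R < ‖y‖ → fderiv ℝ (cutoff R) y = 0 := by
    intro y hy
    have hev : (cutoff (E := EuclideanSpace ℝ (Fin 3)) R) =ᶠ[𝓝 y] fun _ => (0 : ℝ) := by
      filter_upwards [hopen.mem_nhds hy] with z hz
      exact cutoff_eq_zero hR (le_of_lt hz)
    rw [hev.fderiv_eq]; simp
  refine ⟨cutoff_eq_zero hR hx.le, h1 x hx, ?_⟩
  have hev : fderiv ℝ (cutoff (E := EuclideanSpace ℝ (Fin 3)) R) =ᶠ[𝓝 x] fun _ => (0 : (EuclideanSpace ℝ (Fin 3)) →L[ℝ] ℝ) := by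
    filter_upwards [hopen.mem_nhds hx] with z hz
    exact h1 z hz
  rw [hev.fderiv_eq]; simp

/-- support: THE VIRIAL ERROR BOUND.  With `‖Dχ_R‖ ≤ C₁/R` and `‖D²χ_R‖ ≤ C₂/R²`, for every `x`, `v`:
`|2⟪x,v⟫·Dχ_R(x)v + ½|x|²·D²χ_R(x)(v,v)| ≤ (4C₁ + 2C₂)|v|²`, and the left side VANISHES for `|x| < R`. -/
theorem virialError_bound {R C₁ C₂ : ℝ} (hR : 0 < R) (hC₁ : 0 ≤ C₁) (hC₂ : 0 ≤ C₂)
    (h₁ : ∀ x : (EuclideanSpace ℝ (Fin 3)), ‖fderiv ℝ (cutoff R) x‖ ≤ C₁ / R)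
    (h₂ : ∀ x : (EuclideanSpace ℝ (Fin 3)), ‖fderiv ℝ (fderiv ℝ (cutoff R)) x‖ ≤ C₂ / R ^ 2) (x v : (EuclideanSpace ℝ (Fin 3))) :
    |2 * ⟪x, v⟫ * fderiv ℝ (cutoff R) x v + ‖x‖ ^ 2 / 2 * fderiv ℝ (fderiv ℝ (cutoff R)) x v v| ≤
      (4 * C₁ + 2 * C₂) * ‖v‖ ^ 2 := by
  by_cases hout : 2 * R < ‖x‖
  · obtain ⟨-, h1, h2⟩ := cutoff_derivs_eq_zero_outside hR hout
    rw [h1, h2]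
    simp
    positivity
  · push Not at hout
    have hxv : |⟪x, v⟫| ≤ ‖x‖ * ‖v‖ := abs_real_inner_le_norm x v
    have hD1 : |fderiv ℝ (cutoff R) x v| ≤ C₁ / R * ‖v‖ := by
      rw [← Real.norm_eq_abs]
      exact (ContinuousLinearMap.le_opNorm _ _).trans (mul_le_mul_of_nonneg_right (h₁ x) (norm_nonneg _))
    have hD2 : |fderiv ℝ (fderiv ℝ (cutoff R)) x v v| ≤ C₂ / R ^ 2 * ‖v‖ * ‖v‖ := by
      rw [← Real.norm_eq_abs]
      calc ‖fderiv ℝ (fderiv ℝ (cutoff R)) x v v‖ ≤ ‖fderiv ℝ (fderiv ℝ (cutoff R)) x v‖ * ‖v‖ :=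
            ContinuousLinearMap.le_opNorm _ _
        _ ≤ ‖fderiv ℝ (fderiv ℝ (cutoff R)) x‖ * ‖v‖ * ‖v‖ :=
            mul_le_mul_of_nonneg_right (ContinuousLinearMap.le_opNorm _ _) (norm_nonneg _)
        _ ≤ C₂ / R ^ 2 * ‖v‖ * ‖v‖ := by gcongr; exact h₂ x
    have hxR : ‖x‖ ≤ 2 * R := hout
    have hv0 : 0 ≤ ‖v‖ := norm_nonneg _
    have hx0 : 0 ≤ ‖x‖ := norm_nonneg _
    have t1 : |2 * ⟪x, v⟫ * fderiv ℝ (cutoff R) x v| ≤ 4 * C₁ * ‖v‖ ^ 2 := by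
      rw [abs_mul, abs_mul, abs_two]
      calc 2 * |⟪x, v⟫| * |fderiv ℝ (cutoff R) x v| ≤ 2 * (‖x‖ * ‖v‖) * (C₁ / R * ‖v‖) := by
            gcongr
        _ = 2 * (‖x‖ / R) * C₁ * ‖v‖ ^ 2 := by field_simp
        _ ≤ 2 * 2 * C₁ * ‖v‖ ^ 2 := by
            have : ‖x‖ / R ≤ 2 := (div_le_iff₀ hR).2 (by linarith)
            gcongr
        _ = 4 * C₁ * ‖v‖ ^ 2 := by ring
    have t2 : |‖x‖ ^ 2 / 2 * fderiv ℝ (fderiv ℝ (cutoff R)) x v v| ≤ 2 * C₂ * ‖v‖ ^ 2 := by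
      rw [abs_mul, abs_of_nonneg (by positivity : (0 : ℝ) ≤ ‖x‖ ^ 2 / 2)]
      calc ‖x‖ ^ 2 / 2 * |fderiv ℝ (fderiv ℝ (cutoff R)) x v v| ≤ ‖x‖ ^ 2 / 2 * (C₂ / R ^ 2 * ‖v‖ * ‖v‖) := by
            gcongr
        _ = (‖x‖ / R) ^ 2 / 2 * C₂ * ‖v‖ ^ 2 := by field_simp
        _ ≤ 2 ^ 2 / 2 * C₂ * ‖v‖ ^ 2 := by
            have : ‖x‖ / R ≤ 2 := (div_le_iff₀ hR).2 (by linarith)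
            have h0 : 0 ≤ ‖x‖ / R := div_nonneg hx0 hR.le
            gcongr
        _ = 2 * C₂ * ‖v‖ ^ 2 := by ring
    calc |2 * ⟪x, v⟫ * fderiv ℝ (cutoff R) x v + ‖x‖ ^ 2 / 2 * fderiv ℝ (fderiv ℝ (cutoff R)) x v v|
        ≤ |2 * ⟪x, v⟫ * fderiv ℝ (cutoff R) x v| + |‖x‖ ^ 2 / 2 * fderiv ℝ (fderiv ℝ (cutoff R)) x v v| :=
          abs_add_le _ _
      _ ≤ 4 * C₁ * ‖v‖ ^ 2 + 2 * C₂ * ‖v‖ ^ 2 := add_le_add t1 t2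
      _ = (4 * C₁ + 2 * C₂) * ‖v‖ ^ 2 := by ring

/-- support: `⟪a, D(∇θ)(x) v⟫ = D²θ(x)(v)(a)` for `θ ∈ C²`. -/
theorem inner_fderiv_gradient_apply {θ : (EuclideanSpace ℝ (Fin 3)) → ℝ} (hθ : ContDiff ℝ 2 θ) (x v a : (EuclideanSpace ℝ (Fin 3))) :
    ⟪a, fderiv ℝ (gradient θ) x v⟫ = fderiv ℝ (fderiv ℝ θ) x v a := by
  have hd : DifferentiableAt ℝ (fderiv ℝ θ) x :=
    ((hθ.fderiv_right (m := 1) (by norm_cast)).differentiable (by simp)) x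
  have h : HasFDerivAt (gradient θ)
      (((InnerProductSpace.toDual ℝ (EuclideanSpace ℝ (Fin 3))).symm.toContinuousLinearEquiv :
          ((EuclideanSpace ℝ (Fin 3)) →L[ℝ] ℝ) →L[ℝ] (EuclideanSpace ℝ (Fin 3))).comp
        (fderiv ℝ (fderiv ℝ θ) x)) x :=
    (InnerProductSpace.toDual ℝ (EuclideanSpace ℝ (Fin 3))).symm.toContinuousLinearEquiv.hasFDerivAt.comp x hd.hasFDerivAt
  rw [h.fderiv]
  have h2 : (((InnerProductSpace.toDual ℝ (EuclideanSpace ℝ (Fin 3))).symm.toContinuousLinearEquiv :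
        ((EuclideanSpace ℝ (Fin 3)) →L[ℝ] ℝ) →L[ℝ] (EuclideanSpace ℝ (Fin 3))).comp
        (fderiv ℝ (fderiv ℝ θ) x)) v = (InnerProductSpace.toDual ℝ (EuclideanSpace ℝ (Fin 3))).symm (fderiv ℝ (fderiv ℝ θ) x v) := rfl
  rw [h2, real_inner_comm, InnerProductSpace.toDual_symm_apply]

/-- support: `∇θ ∈ C¹` for `θ ∈ C²`. -/
theorem contDiff_one_gradient {θ : (EuclideanSpace ℝ (Fin 3)) → ℝ} (hθ : ContDiff ℝ 2 θ) : ContDiff ℝ 1 (gradient θ) :=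
  (InnerProductSpace.toDual ℝ (EuclideanSpace ℝ (Fin 3))).symm.contDiff.comp (hθ.fderiv_right (m := 1) (by norm_cast))

/-- support: `∇θ` has compact support when `θ` does. -/
theorem hasCompactSupport_gradient' {θ : (EuclideanSpace ℝ (Fin 3)) → ℝ} (hθc : HasCompactSupport θ) : HasCompactSupport (gradient θ) :=
  hθc.mono' fun y hy => by
    contrapose! hy
    simp only [mem_support, not_not]
    exact gradient_eq_zero_of_notMem_tsupport hy

/-- ★ THE TESTED VIRIAL IDENTITY.  For `u ∈ C²(ℝ³;ℝ³)` divergence free with `div((u·∇)u) ≡ 0` and every compactly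
supported `θ ∈ C²`: `∫ D²θ(x)(u(x),u(x)) dx = 0` (test `div((u·∇)u) = 0` against `θ`, integrate by parts twice:
`0 = ∫ θ·div((u·∇)u) = −∫⟪(u·∇)u, ∇θ⟫ = ∫⟪u, (u·∇)∇θ⟫ = ∫ D²θ(u,u)`). -/
theorem integral_hessian_apply_self_eq_zero {u : (EuclideanSpace ℝ (Fin 3)) → (EuclideanSpace ℝ (Fin 3))} (hu : ContDiff ℝ 2 u)
    (hdiv : VectorCalculus.IsDivFree u) (hw : ∀ x, VectorCalculus.divergence (convect u u) x = 0)
    {θ : (EuclideanSpace ℝ (Fin 3)) → ℝ} (hθ : ContDiff ℝ 2 θ) (hθc : HasCompactSupport θ) :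
    ∫ x, fderiv ℝ (fderiv ℝ θ) x (u x) (u x) = 0 := by
  have hu1 : ContDiff ℝ 1 u := hu.of_le (by norm_cast)
  have hθ1 : ContDiff ℝ 1 θ := hθ.of_le (by norm_cast)
  have hg1 := contDiff_one_gradient hθ
  have hgc := hasCompactSupport_gradient' hθc
  have hw1 : ContDiff ℝ 1 (convect u u) := by
    show ContDiff ℝ 1 fun x => fderiv ℝ u x (u x)
    exact (hu.fderiv_right (m := 1) (by norm_cast)).clm_apply hu1
  have A := integral_inner_convect_add_eq_zero (u := u) (v := u) (w := gradient θ) hu1 hu1 hg1 hgc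
  have B := integral_mul_divergence_add_eq_zero_left hθ1 hw1 hθc
  have hB1 : ∫ x, θ x * VectorCalculus.divergence (convect u u) x = 0 := by
    simp [hw]
  have hA3 : ∫ x, VectorCalculus.divergence u x * ⟪u x, gradient θ x⟫ = 0 := by
    simp [hdiv _]
  rw [hB1, zero_add] at B
  rw [B, hA3, zero_add, add_zero] at A
  rw [← A]
  refine integral_congr_ae (Eventually.of_forall fun x => ?_)
  show fderiv ℝ (fderiv ℝ θ) x (u x) (u x) = ⟪u x, convect u (gradient θ) x⟫
  rw [show convect u (gradient θ) x = fderiv ℝ (gradient θ) x (u x) from rfl, inner_fderiv_gradient_apply hθ]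


/-- ★★ VIRIAL LIQUIDATION.  A `C²` divergence-free vector field `u` on `ℝ³` with FINITE ENERGY (`|u|² ∈ L¹`) whose
convective derivative is itself divergence free, `div((u·∇)u) ≡ 0` (equivalently `tr((∇u)²) ≡ 0`, `|S|² ≡ ½|ω|²`),
VANISHES IDENTICALLY.  Proof: the tested virial identity with `θ_R = ½|x|²χ_R` gives
`∫ χ_R|u|² = −∫ (2⟪x,u⟫Dχ_R(u) + ½|x|²D²χ_R(u,u))`, whose right side is `O(∫_{|x| ≥ R}|u|²) → 0`, while the left
side tends to `∫|u|²` (tensor virial theorem; cf. Chae's Liouville theorems for steady Euler via `∫(|u|² + 3p) = 0`). -/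
theorem eq_zero_of_divergence_convect_self_eq_zero {u : (EuclideanSpace ℝ (Fin 3)) → (EuclideanSpace ℝ (Fin 3))} (hu : ContDiff ℝ 2 u)
    (hdiv : VectorCalculus.IsDivFree u) (hL2 : Integrable (fun x => ‖u x‖ ^ 2))
    (hw : ∀ x, VectorCalculus.divergence (convect u u) x = 0) : u = 0 := by
  obtain ⟨C₁, hC₁, h₁⟩ := exists_norm_fderiv_cutoff_le (E := EuclideanSpace ℝ (Fin 3))
  obtain ⟨C₂, hC₂, h₂⟩ := exists_norm_fderiv_fderiv_cutoff_le (E := EuclideanSpace ℝ (Fin 3))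
  set K : ℝ := 4 * C₁ + 2 * C₂ with hK
  have hK0 : 0 ≤ K := by positivity
  have huc : Continuous u := hu.continuous
  -- the error term and its bound
  set err : ℝ → (EuclideanSpace ℝ (Fin 3)) → ℝ := fun R x =>
    2 * ⟪x, u x⟫ * fderiv ℝ (cutoff R) x (u x) + ‖x‖ ^ 2 / 2 * fderiv ℝ (fderiv ℝ (cutoff R)) x (u x) (u x) with herr
  have herr_le : ∀ R, 0 < R → ∀ x, |err R x| ≤ ({y : (EuclideanSpace ℝ (Fin 3)) | R ≤ ‖y‖}.indicator (fun y => K * ‖u y‖ ^ 2)) x := by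
    intro R hR x
    by_cases hx : R ≤ ‖x‖
    · rw [indicator_of_mem (show x ∈ {y : (EuclideanSpace ℝ (Fin 3)) | R ≤ ‖y‖} from hx)]
      exact virialError_bound hR hC₁ hC₂ (h₁ R hR) (h₂ R hR) x (u x)
    · rw [indicator_of_notMem (show x ∉ {y : (EuclideanSpace ℝ (Fin 3)) | R ≤ ‖y‖} from hx)]
      obtain ⟨h1, h2⟩ := fderiv_cutoff_eq_zero_inside hR (lt_of_not_ge hx)
      simp [herr, h1, h2]
  -- the identity `∫ χ_R |u|² = -∫ err_R`
  have hmain : ∀ R, 0 < R → ∫ x, cutoff R x * ‖u x‖ ^ 2 = -∫ x, err R x := by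
    intro R hR
    have hθ : ContDiff ℝ 2 (fun y : (EuclideanSpace ℝ (Fin 3)) => ‖y‖ ^ 2 / 2 * cutoff R y) := contDiff_virialTest R
    have hθc : HasCompactSupport (fun y : (EuclideanSpace ℝ (Fin 3)) => ‖y‖ ^ 2 / 2 * cutoff R y) :=
      (hasCompactSupport_cutoff hR).mul_left
    have h0 := integral_hessian_apply_self_eq_zero hu hdiv hw hθ hθc
    have hsplit : ∀ x, fderiv ℝ (fderiv ℝ (fun y : (EuclideanSpace ℝ (Fin 3)) => ‖y‖ ^ 2 / 2 * cutoff R y)) x (u x) (u x) =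
        cutoff R x * ‖u x‖ ^ 2 + err R x := fun x => by
      rw [fderiv_fderiv_virialTest_apply]; simp only [herr]; ring
    simp_rw [hsplit] at h0
    -- integrability of the two pieces
    have hi1 : Integrable fun x => cutoff R x * ‖u x‖ ^ 2 := by
      refine hL2.mono' (((contDiff_cutoff (n := 0) R).continuous.mul (huc.norm.pow 2)).aestronglyMeasurable)
        (Eventually.of_forall fun x => ?_)
      rw [Real.norm_eq_abs, abs_mul, abs_of_nonneg (sq_nonneg ‖u x‖)]
      calc |cutoff R x| * ‖u x‖ ^ 2 ≤ 1 * ‖u x‖ ^ 2 :=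
            mul_le_mul_of_nonneg_right (abs_cutoff_le_one R x) (sq_nonneg _)
        _ = ‖u x‖ ^ 2 := one_mul _
    have hi2 : Integrable (err R) := by
      have hc : Continuous (err R) := by
        have hd1 : Continuous (fderiv ℝ (cutoff (E := EuclideanSpace ℝ (Fin 3)) R)) :=
          (contDiff_cutoff (n := 1) R).continuous_fderiv (by simp)
        have hd2 : Continuous (fderiv ℝ (fderiv ℝ (cutoff (E := EuclideanSpace ℝ (Fin 3)) R))) :=
          ((contDiff_cutoff (n := 2) R).fderiv_right (m := 1) (by norm_cast)).continuous_fderiv (by simp)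
        simp only [herr]
        fun_prop
      refine (hL2.const_mul K).mono' hc.aestronglyMeasurable (Eventually.of_forall fun x => ?_)
      rw [Real.norm_eq_abs]
      refine (herr_le R hR x).trans ?_
      by_cases hx : x ∈ {y : (EuclideanSpace ℝ (Fin 3)) | R ≤ ‖y‖}
      · rw [indicator_of_mem hx]
      · rw [indicator_of_notMem hx]; positivity
    rw [integral_add hi1 hi2] at h0
    linarith
  -- the bound `|∫ χ_R |u|²| ≤ ∫_{|x| ≥ R} K|u|²`
  have hbound : ∀ R, 0 < R → |∫ x, cutoff R x * ‖u x‖ ^ 2| ≤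
      ∫ x, {y : (EuclideanSpace ℝ (Fin 3)) | R ≤ ‖y‖}.indicator (fun y => K * ‖u y‖ ^ 2) x := by
    intro R hR
    rw [hmain R hR, abs_neg]
    refine (abs_integral_le_integral_abs (f := err R)).trans ?_
    refine integral_mono_of_nonneg (Eventually.of_forall fun x => abs_nonneg _) ?_
      (Eventually.of_forall (herr_le R hR))
    exact (hL2.const_mul K).indicator (isClosed_le continuous_const continuous_norm).measurableSet
  -- pass to the limit along `R = n + 1`
  have hlim1 : Tendsto (fun n : ℕ => ∫ x, cutoff ((n : ℝ) + 1) x * ‖u x‖ ^ 2) atTop (𝓝 (∫ x, ‖u x‖ ^ 2)) := by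
    refine tendsto_integral_of_dominated_convergence (fun x => ‖u x‖ ^ 2) (fun n => ?_) hL2 (fun n => ?_) ?_
    · exact ((contDiff_cutoff (n := 0) _).continuous.mul (huc.norm.pow 2)).aestronglyMeasurable
    · refine Eventually.of_forall fun x => ?_
      rw [Real.norm_eq_abs, abs_mul, abs_of_nonneg (sq_nonneg ‖u x‖)]
      calc |cutoff ((n : ℝ) + 1) x| * ‖u x‖ ^ 2 ≤ 1 * ‖u x‖ ^ 2 :=
            mul_le_mul_of_nonneg_right (abs_cutoff_le_one _ x) (sq_nonneg _)
        _ = ‖u x‖ ^ 2 := one_mul _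
    · refine Eventually.of_forall fun x => ?_
      have h := (tendsto_cutoff_natCast_add_one x).mul_const (‖u x‖ ^ 2)
      rwa [one_mul] at h
  have hlim2 : Tendsto (fun n : ℕ => ∫ x, {y : (EuclideanSpace ℝ (Fin 3)) | ((n : ℝ) + 1) ≤ ‖y‖}.indicator (fun y => K * ‖u y‖ ^ 2) x)
      atTop (𝓝 0) := by
    have h := tendsto_integral_of_dominated_convergence (F := fun (n : ℕ) x =>
        {y : (EuclideanSpace ℝ (Fin 3)) | ((n : ℝ) + 1) ≤ ‖y‖}.indicator (fun y => K * ‖u y‖ ^ 2) x) (f := fun _ => (0 : ℝ))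
      (μ := volume) (fun x => K * ‖u x‖ ^ 2) (fun n => ?_) (hL2.const_mul K) (fun n => ?_) ?_
    · simpa using h
    · exact ((hL2.const_mul K).indicator
        (isClosed_le continuous_const continuous_norm).measurableSet).aestronglyMeasurable
    · refine Eventually.of_forall fun x => ?_
      rw [Real.norm_eq_abs]
      by_cases hx : x ∈ {y : (EuclideanSpace ℝ (Fin 3)) | ((n : ℝ) + 1) ≤ ‖y‖}
      · rw [indicator_of_mem hx, abs_of_nonneg (by positivity)]
      · rw [indicator_of_notMem hx, abs_zero]; positivity
    · refine Eventually.of_forall fun x => ?_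
      apply tendsto_const_nhds.congr'
      filter_upwards [eventually_gt_atTop ⌈‖x‖⌉₊] with n hn
      have hlt : ‖x‖ < (n : ℝ) + 1 := by
        have := Nat.lt_of_ceil_lt hn
        linarith [this]
      rw [indicator_of_notMem]
      simp only [mem_setOf_eq, not_le]
      exact hlt
  -- conclude `∫ |u|² = 0`
  have hI0 : ∫ x, ‖u x‖ ^ 2 = 0 := by
    have habs : Tendsto (fun n : ℕ => |∫ x, cutoff ((n : ℝ) + 1) x * ‖u x‖ ^ 2|) atTop (𝓝 |∫ x, ‖u x‖ ^ 2|) :=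
      hlim1.abs
    have hle : |∫ x, ‖u x‖ ^ 2| ≤ 0 :=
      le_of_tendsto_of_tendsto' habs hlim2 fun n => hbound _ (by positivity)
    exact abs_eq_zero.1 (le_antisymm hle (abs_nonneg _))
  -- and `u ≡ 0`
  have hae : (fun x => ‖u x‖ ^ 2) =ᵐ[volume] 0 :=
    (integral_eq_zero_iff_of_nonneg (fun x => sq_nonneg _) hL2).1 hI0
  have hfun : (fun x => ‖u x‖ ^ 2) = 0 :=
    (Continuous.ae_eq_iff_eq volume (huc.norm.pow 2) continuous_const).1 hae
  funext x
  have := congrFun hfun x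
  simpa using this

end Summit.NavierStokesRegularity.NavierStokesRegularity.Theorems.StrainDoors

end
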